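import Literature.NumberTheory.ConnesConsani2021.ProlateProjections
import HarnessLib

/-!
# `δ(1) = 2(Si(4π)/(4π) + 1) = 2.237484835…` — the printed numerical check of Remark 4.6 (i), certified

LINE 1 — FRAMING: RH-FREE classical analysis (the Taylor series of the sine integral and a kernel-checked
rational enclosure of `Si(4π)`); cell rh-crit, corpus C1 (Connes–Consani 2021), seat t3 (row = CC2021 §4
first part, statement layer `ProlateProjections.lean`); bears_on: W-C/W-P (§4 FACT-LIST rows of apex input
(A); OFF the closing path of every route item).  WHAT THIS IS NOT: any claim about RH — nothing here bears
on the truth of RH; a numerical check in a criterion paper is RH-FREE literature.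

Topic `NumberTheory/ConnesConsani2021`; namespace `Literature.NumberTheory.ConnesConsani2021`.  THEOREMS ONLY
(no definition, no named fact).  This module DISCHARGES the named fact

* `CC2021_rem_4_6_i_numerics : |traceRemainder 1 − 2.237484835| ≤ 10⁻⁹`

(Connes–Consani 2021, Remark 4.6 (i), §4 p. 18: "one checks numerically that both sides are
`∼ 2.237484835`"; typed by seat t3 g1 as an enclosure of one unit in the last printed digit; the tree's
`traceRemainder_one : traceRemainder 1 = 2(Si(4π)/(4π) + 1)`), WITHOUT any numerical hypothesis: the true
value is `δ(1) = 2.23748483494182753866…` (printed − true = `+5.8·10⁻¹¹`).  The asymptotic enclosure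
`abs_sinIntegral_four_pi_sub_le` of `SineIntegralAsymptotics.lean` (`± 6/(4π)⁴ ≈ 2.4·10⁻⁴`) cannot reach
`10⁻⁹` at `x = 4π` (optimal truncation of the asymptotic series there is `≈ 2·10⁻⁶`), so we use the
convergent Taylor series instead:

* `hasSum_sin_div_self` — `sin t/t = Σ_k (−1)^k t^{2k}/(2k+1)!` (`t ≠ 0`);
* `hasSum_sinIntegral_taylor` — **`Si(x) = Σ_k (−1)^k x^{2k+1}/((2k+1)·(2k+1)!)`** for every real `x`
  (term-wise integration, dominated convergence);
* `abs_sinIntegral_sub_taylor_le` — the tail after `N` terms is at most `2|x|^{2N+1}/(2N+1)!` as soon as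
  `2x² ≤ (2N+2)(2N+3)` (geometric domination of the tail, ratio `≤ 1/2`);
* `sum_alternating_odd_pow_bounds` — split-sign evaluation of an alternating odd polynomial on an
  interval `0 ≤ lo ≤ z ≤ hi`;
* `sinIntegral_four_pi_mem_Icc` — **`1.492161225 ≤ Si(4π) ≤ 1.492161226`** (`N = 25`, `π` to 20 digits
  from Mathlib's `Real.pi_gt_d20` / `Real.pi_lt_d20`, the 25-term rational sums evaluated by `norm_num`);
* `traceRemainder_one_mem_Icc` and **`CC2021_rem_4_6_i_numerics_holds`**.

## References

* A. Connes, C. Consani, *Weil positivity and trace formula, the archimedean place*, Selecta Math. 27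
  (2021) 77 = arXiv:2006.13771, §2 eq. (26) p. 11 (`δ(1) = 2(Si(4π)/(4π)+1)`), Remark 4.6 (i) §4 p. 18
  (arXiv item Remark 26, chunk p0018:L2–L5: "both sides are `∼ 2.237484835`"). [ConnesConsani2021]
* E. C. Titchmarsh, *Introduction to the Theory of Fourier Integrals*, 2nd ed. (1948), §1.9 (the sine
  integral). [Titchmarsh1948]
* M. Abramowitz, I. A. Stegun (eds.), *Handbook of Mathematical Functions*, NBS AMS 55 (1964), §5.2
  «Series Expansions», eq. 5.2.14 p. 232: `Si(z) = Σ_{n≥0} (−1)^n z^{2n+1}/((2n+1)(2n+1)!)` (read in the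
  scanned book, galaxy panama:379812547919942). [AbramowitzStegun1964]
* NIST Digital Library of Mathematical Functions, §6.6 eq. 6.6.5 (the same series). [DLMF]
-/

noncomputable section

open Filter Topology Set MeasureTheory intervalIntegral Finset
open scoped Real Interval

namespace Literature.NumberTheory.ConnesConsani2021

/-! ## The Taylor series of the sine integral -/

/-- `sin t / t = Σ_k (−1)^k t^{2k}/(2k+1)!` for `t ≠ 0` (divide Mathlib's `Real.hasSum_sin` by `t`).
[folklore] -/
private theorem hasSum_sin_div_self {t : ℝ} (ht : t ≠ 0) :
    HasSum (fun k : ℕ => (-1 : ℝ) ^ k * t ^ (2 * k) / (Nat.factorial (2 * k + 1) : ℝ))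
      (Real.sin t / t) := by
  have h := (Real.hasSum_sin t).div_const t
  have hfun : (fun k : ℕ => (-1 : ℝ) ^ k * t ^ (2 * k) / (Nat.factorial (2 * k + 1) : ℝ))
      = fun k : ℕ => (-1 : ℝ) ^ k * t ^ (2 * k + 1) / (Nat.factorial (2 * k + 1) : ℝ) / t := by
    funext k
    rw [pow_succ]
    field_simp
  rw [hfun]
  exact h

/-- On the integration range `Ι 0 x` one has `|t| ≤ |x|`. [folklore] -/
private theorem abs_le_abs_of_mem_uIoc_zero {x t : ℝ} (ht : t ∈ Ι (0 : ℝ) x) : |t| ≤ |x| := by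
  rw [Set.mem_uIoc] at ht
  rcases ht with ⟨h1, h2⟩ | ⟨h1, h2⟩
  · rw [abs_of_pos h1]
    exact h2.trans (le_abs_self x)
  · rw [abs_of_nonpos h2]
    have : x < 0 := lt_of_lt_of_le h1 h2
    rw [abs_of_neg this]
    linarith

/-- **The Taylor series of the sine integral**: for every real `x`,
`Si(x) = ∫₀ˣ sin t/t dt = Σ_{k ≥ 0} (−1)^k x^{2k+1} / ((2k+1)·(2k+1)!)` (term-wise integration of the
sine series, justified by dominated convergence with the summable majorant `|x|^{2k}/(2k)!`).
[cite: AbramowitzStegun1964, §5.2 eq. 5.2.14 p. 232 («Series Expansions»); DLMF, §6.6 eq. 6.6.5] -/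
theorem hasSum_sinIntegral_taylor (x : ℝ) :
    HasSum (fun k : ℕ => (-1 : ℝ) ^ k * x ^ (2 * k + 1) /
        ((2 * k + 1 : ℝ) * (Nat.factorial (2 * k + 1) : ℝ))) (sinIntegral x) := by
  have hmaj : Summable fun k : ℕ => |x| ^ (2 * k) / (Nat.factorial (2 * k) : ℝ) := by
    have h := (Real.summable_pow_div_factorial |x|).comp_injective
      (show Function.Injective fun k : ℕ => 2 * k from fun a b hab => by simpa using hab)
    exact h
  have key : HasSum (fun k : ℕ => ∫ t in (0 : ℝ)..x,
      (-1 : ℝ) ^ k * t ^ (2 * k) / (Nat.factorial (2 * k + 1) : ℝ))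
      (∫ t in (0 : ℝ)..x, Real.sin t / t) := by
    refine intervalIntegral.hasSum_integral_of_dominated_convergence
      (fun k _ => |x| ^ (2 * k) / (Nat.factorial (2 * k) : ℝ)) ?_ ?_ ?_ ?_ ?_
    · intro k
      exact (by fun_prop : Continuous fun t : ℝ =>
        (-1 : ℝ) ^ k * t ^ (2 * k) / (Nat.factorial (2 * k + 1) : ℝ)).aestronglyMeasurable
    · intro k
      refine Eventually.of_forall fun t ht => ?_
      have htx : |t| ≤ |x| := abs_le_abs_of_mem_uIoc_zero ht
      rw [Real.norm_eq_abs, abs_div, abs_mul, abs_pow, abs_pow, abs_neg, abs_one, one_pow, one_mul,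
        Nat.abs_cast]
      have hfac : ((Nat.factorial (2 * k) : ℕ) : ℝ) ≤ (Nat.factorial (2 * k + 1) : ℕ) := by
        exact_mod_cast Nat.factorial_le (Nat.le_succ _)
      have hfpos : (0 : ℝ) < (Nat.factorial (2 * k) : ℕ) := by
        exact_mod_cast Nat.factorial_pos _
      calc |t| ^ (2 * k) / ((Nat.factorial (2 * k + 1) : ℕ) : ℝ)
          ≤ |t| ^ (2 * k) / ((Nat.factorial (2 * k) : ℕ) : ℝ) :=
            div_le_div_of_nonneg_left (by positivity) hfpos hfac
        _ ≤ |x| ^ (2 * k) / ((Nat.factorial (2 * k) : ℕ) : ℝ) := by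
            gcongr
    · exact Eventually.of_forall fun t _ => hmaj
    · exact intervalIntegrable_const
    · have hae : ∀ᵐ t : ℝ ∂volume, t ≠ 0 := by
        rw [ae_iff]
        simp
      filter_upwards [hae] with t ht _ using hasSum_sin_div_self ht
  have hint : ∀ k : ℕ, (∫ t in (0 : ℝ)..x,
      (-1 : ℝ) ^ k * t ^ (2 * k) / (Nat.factorial (2 * k + 1) : ℝ))
      = (-1 : ℝ) ^ k * x ^ (2 * k + 1) / ((2 * k + 1 : ℝ) * (Nat.factorial (2 * k + 1) : ℝ)) := by
    intro k
    have hfun : (fun t : ℝ => (-1 : ℝ) ^ k * t ^ (2 * k) / (Nat.factorial (2 * k + 1) : ℝ))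
        = fun t : ℝ => ((-1 : ℝ) ^ k / (Nat.factorial (2 * k + 1) : ℝ)) * t ^ (2 * k) := by
      funext t; ring
    rw [hfun, intervalIntegral.integral_const_mul, integral_pow]
    have h0 : (0 : ℝ) ^ (2 * k + 1) = 0 := zero_pow (Nat.succ_ne_zero _)
    rw [h0, sub_zero]
    push_cast
    have hne : (2 * (k : ℝ) + 1) ≠ 0 := by positivity
    field_simp
  unfold sinIntegral
  convert key using 1
  funext k
  exact (hint k).symm

/-- The modulus of the `k`-th Taylor term is at most `|x|^{2k+1}/(2k+1)!`. [folklore] -/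
private theorem abs_sinIntegral_taylor_term_le (x : ℝ) (k : ℕ) :
    |(-1 : ℝ) ^ k * x ^ (2 * k + 1) / ((2 * k + 1 : ℝ) * (Nat.factorial (2 * k + 1) : ℝ))|
      ≤ |x| ^ (2 * k + 1) / (Nat.factorial (2 * k + 1) : ℝ) := by
  rw [abs_div, abs_mul, abs_pow, abs_neg, abs_one, one_pow, one_mul, abs_pow, abs_mul,
    Nat.abs_cast, abs_of_pos (by positivity : (0 : ℝ) < 2 * k + 1)]
  have hfpos : (0 : ℝ) < (Nat.factorial (2 * k + 1) : ℕ) := by exact_mod_cast Nat.factorial_pos _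
  refine div_le_div_of_nonneg_left (by positivity) hfpos ?_
  have : (1 : ℝ) ≤ 2 * k + 1 := by
    have : (0 : ℝ) ≤ k := Nat.cast_nonneg k
    linarith
  calc ((Nat.factorial (2 * k + 1) : ℕ) : ℝ) = 1 * (Nat.factorial (2 * k + 1) : ℕ) := (one_mul _).symm
    _ ≤ (2 * k + 1) * (Nat.factorial (2 * k + 1) : ℕ) := by gcongr

/-- The majorant `g_k = |x|^{2k+1}/(2k+1)!` satisfies `g_{k+1} = g_k · x²/((2k+2)(2k+3))`. [folklore] -/
private theorem sinIntegral_majorant_succ (x : ℝ) (k : ℕ) :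
    |x| ^ (2 * (k + 1) + 1) / (Nat.factorial (2 * (k + 1) + 1) : ℝ)
      = |x| ^ (2 * k + 1) / (Nat.factorial (2 * k + 1) : ℝ) *
          (x ^ 2 / ((2 * k + 2) * (2 * k + 3) : ℝ)) := by
  have h1 : 2 * (k + 1) + 1 = (2 * k + 2) + 1 := by ring
  have h2 : 2 * k + 2 = (2 * k + 1) + 1 := by ring
  rw [h1, Nat.factorial_succ, h2, Nat.factorial_succ]
  rw [show (2 * k + 1 + 1 + 1 : ℕ) = 2 * k + 3 by ring, show (2 * k + 1 + 1 : ℕ) = 2 * k + 2 by ring]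
  push_cast
  have hf : (0 : ℝ) < (Nat.factorial (2 * k + 1) : ℕ) := by exact_mod_cast Nat.factorial_pos _
  rw [show |x| ^ (2 * k + 3) = |x| ^ (2 * k + 1) * |x| ^ 2 by ring, sq_abs]
  field_simp

/-- **Tail of the Taylor series of `Si`**: if `2x² ≤ (2N+2)(2N+3)` then
`|Si(x) − Σ_{k<N} (−1)^k x^{2k+1}/((2k+1)(2k+1)!)| ≤ 2|x|^{2N+1}/(2N+1)!` (the tail is dominated by a
geometric series of ratio `1/2`). [cite: AbramowitzStegun1964, §5.2 eq. 5.2.14 p. 232 (tail of the series); DLMF, §6.6 eq. 6.6.5] -/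
theorem abs_sinIntegral_sub_taylor_le (x : ℝ) (N : ℕ)
    (hN : 2 * x ^ 2 ≤ ((2 * N + 2) * (2 * N + 3) : ℝ)) :
    |sinIntegral x - ∑ k ∈ Finset.range N, (-1 : ℝ) ^ k * x ^ (2 * k + 1) /
        ((2 * k + 1 : ℝ) * (Nat.factorial (2 * k + 1) : ℝ))|
      ≤ 2 * (|x| ^ (2 * N + 1) / (Nat.factorial (2 * N + 1) : ℝ)) := by
  set f : ℕ → ℝ := fun k => (-1 : ℝ) ^ k * x ^ (2 * k + 1) /
    ((2 * k + 1 : ℝ) * (Nat.factorial (2 * k + 1) : ℝ)) with hf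
  set g : ℕ → ℝ := fun k => |x| ^ (2 * k + 1) / (Nat.factorial (2 * k + 1) : ℝ) with hg
  have hsum : HasSum f (sinIntegral x) := hasSum_sinIntegral_taylor x
  have hs : Summable f := hsum.summable
  have hsplit := hs.sum_add_tsum_nat_add N
  rw [hsum.tsum_eq] at hsplit
  have htail : sinIntegral x - ∑ k ∈ Finset.range N, f k = ∑' j, f (j + N) := by linarith
  rw [htail]
  -- majorant properties
  have hfg : ∀ k, |f k| ≤ g k := fun k => abs_sinIntegral_taylor_term_le x k
  have hg_succ : ∀ k, g (k + 1) = g k * (x ^ 2 / ((2 * k + 2) * (2 * k + 3) : ℝ)) :=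
    fun k => sinIntegral_majorant_succ x k
  have hratio : ∀ k, N ≤ k → x ^ 2 / ((2 * k + 2) * (2 * k + 3) : ℝ) ≤ 1 / 2 := by
    intro k hk
    have hk' : (N : ℝ) ≤ k := by exact_mod_cast hk
    rw [div_le_iff₀ (by positivity)]
    nlinarith
  have hgeo : ∀ j, g (j + N) ≤ g N * (1 / 2) ^ j := by
    intro j
    induction j with
    | zero => simp
    | succ j ih =>
      rw [show j + 1 + N = (j + N) + 1 by ring, hg_succ, pow_succ]
      have hgN : 0 ≤ g N := by positivity
      calc g (j + N) * (x ^ 2 / ((2 * ((j + N : ℕ) : ℝ) + 2) * (2 * ((j + N : ℕ) : ℝ) + 3)))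
          ≤ (g N * (1 / 2) ^ j) * (1 / 2) :=
            mul_le_mul ih (hratio (j + N) (by omega)) (by positivity) (by positivity)
        _ = g N * ((1 / 2) ^ j * (1 / 2)) := by ring
  have hshift : HasSum (fun j => f (j + N)) (∑' j, f (j + N)) :=
    ((hasSum_nat_add_iff' N).mpr hsum).summable.hasSum
  have hgeom : HasSum (fun j : ℕ => g N * (1 / 2 : ℝ) ^ j) (g N * 2) := by
    have h := (hasSum_geometric_of_lt_one (by norm_num : (0 : ℝ) ≤ 1 / 2)
      (by norm_num : (1 / 2 : ℝ) < 1)).mul_left (g N)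
    have h2 : g N * (1 - 1 / 2 : ℝ)⁻¹ = g N * 2 := by norm_num
    rw [h2] at h
    exact h
  have hle : ∀ j, ‖f (j + N)‖ ≤ g N * (1 / 2 : ℝ) ^ j := fun j => by
    rw [Real.norm_eq_abs]
    exact (hfg _).trans (hgeo j)
  have := hshift.norm_le_of_bounded hgeom hle
  rw [Real.norm_eq_abs] at this
  linarith

/-! ## Split-sign evaluation of the Taylor polynomial on an interval -/

/-- For `0 ≤ lo ≤ z ≤ hi` and non-negative coefficients `c k`, the alternating odd polynomial
`Σ_{k<N} (−1)^k c_k z^{2k+1}` is enclosed by evaluating the even-indexed terms at one endpoint and the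
odd-indexed ones at the other. [folklore] -/
private theorem sum_alternating_odd_pow_bounds (N : ℕ) (c : ℕ → ℝ) (hc : ∀ k, 0 ≤ c k)
    {lo hi z : ℝ} (hlo : 0 ≤ lo) (h1 : lo ≤ z) (h2 : z ≤ hi) :
    (∑ k ∈ Finset.range N, c k * ((1 + (-1 : ℝ) ^ k) / 2 * lo ^ (2 * k + 1)
        - (1 - (-1 : ℝ) ^ k) / 2 * hi ^ (2 * k + 1)))
      ≤ ∑ k ∈ Finset.range N, (-1 : ℝ) ^ k * c k * z ^ (2 * k + 1) ∧
    (∑ k ∈ Finset.range N, (-1 : ℝ) ^ k * c k * z ^ (2 * k + 1))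
      ≤ ∑ k ∈ Finset.range N, c k * ((1 + (-1 : ℝ) ^ k) / 2 * hi ^ (2 * k + 1)
        - (1 - (-1 : ℝ) ^ k) / 2 * lo ^ (2 * k + 1)) := by
  have hz : 0 ≤ z := hlo.trans h1
  have hpl : ∀ k, lo ^ (2 * k + 1) ≤ z ^ (2 * k + 1) := fun k => pow_le_pow_left₀ hlo h1 _
  have hph : ∀ k, z ^ (2 * k + 1) ≤ hi ^ (2 * k + 1) := fun k => pow_le_pow_left₀ hz h2 _
  constructor
  · refine Finset.sum_le_sum fun k _ => ?_
    rcases Nat.even_or_odd k with he | ho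
    · rw [he.neg_one_pow]
      have := mul_le_mul_of_nonneg_left (hpl k) (hc k)
      norm_num
      linarith
    · rw [ho.neg_one_pow]
      have := mul_le_mul_of_nonneg_left (hph k) (hc k)
      norm_num
      linarith
  · refine Finset.sum_le_sum fun k _ => ?_
    rcases Nat.even_or_odd k with he | ho
    · rw [he.neg_one_pow]
      have := mul_le_mul_of_nonneg_left (hph k) (hc k)
      norm_num
      linarith
    · rw [ho.neg_one_pow]
      have := mul_le_mul_of_nonneg_left (hpl k) (hc k)
      norm_num
      linarith

/-! ## The enclosure of `Si(4π)` and of `δ(1)` -/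

/-- `12.566370614359172 < 4π` (from Mathlib's `Real.pi_gt_d20`). [folklore] -/
private theorem lt_four_mul_pi : (12.566370614359172 : ℝ) < 4 * π := by
  have := Real.pi_gt_d20
  linarith

/-- `4π < 12.566370614359173` (from Mathlib's `Real.pi_lt_d20`). [folklore] -/
private theorem four_mul_pi_lt : 4 * π < (12.566370614359173 : ℝ) := by
  have := Real.pi_lt_d20
  linarith

/-- The kernel-checked rational core: with `lo = 12.566370614359172`, `hi = 12.566370614359173`, the
split-sign bounds of the 25-term Taylor polynomial of `Si`, widened by the tail bound `2·hi^51/51!`, lie in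
`[1.492161225, 1.492161226]`. [folklore] -/
private theorem sinIntegral_taylor25_core :
    (1.492161225 : ℝ) + 2 * ((12.566370614359173 : ℝ) ^ (2 * 25 + 1) / (Nat.factorial (2 * 25 + 1) : ℝ))
      ≤ ∑ k ∈ Finset.range 25, (1 / ((2 * k + 1 : ℝ) * (Nat.factorial (2 * k + 1) : ℝ))) *
          ((1 + (-1 : ℝ) ^ k) / 2 * (12.566370614359172 : ℝ) ^ (2 * k + 1)
            - (1 - (-1 : ℝ) ^ k) / 2 * (12.566370614359173 : ℝ) ^ (2 * k + 1)) ∧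
    (∑ k ∈ Finset.range 25, (1 / ((2 * k + 1 : ℝ) * (Nat.factorial (2 * k + 1) : ℝ))) *
          ((1 + (-1 : ℝ) ^ k) / 2 * (12.566370614359173 : ℝ) ^ (2 * k + 1)
            - (1 - (-1 : ℝ) ^ k) / 2 * (12.566370614359172 : ℝ) ^ (2 * k + 1)))
      + 2 * ((12.566370614359173 : ℝ) ^ (2 * 25 + 1) / (Nat.factorial (2 * 25 + 1) : ℝ))
      ≤ (1.492161226 : ℝ) := by
  constructor
  · simp only [Finset.sum_range_succ, Finset.sum_range_zero, Nat.factorial]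
    norm_num
  · simp only [Finset.sum_range_succ, Finset.sum_range_zero, Nat.factorial]
    norm_num

/-- **`Si(4π)` enclosed to `10⁻⁹` without numerics-as-hypothesis**: `1.492161225 ≤ Si(4π) ≤ 1.492161226`
(true value `1.4921612255844600…`). [cite: ConnesConsani2021, Remark 4.6 (i) §4 p. 18 (arXiv chunk p0018:L2–L5); Titchmarsh1948, §1.9] -/
theorem sinIntegral_four_pi_mem_Icc :
    (1.492161225 : ℝ) ≤ sinIntegral (4 * π) ∧ sinIntegral (4 * π) ≤ (1.492161226 : ℝ) := by
  have hlo := lt_four_mul_pi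
  have hhi := four_mul_pi_lt
  have hpos : (0 : ℝ) < 4 * π := by positivity
  -- tail
  have hN : 2 * (4 * π) ^ 2 ≤ ((2 * (25 : ℕ) + 2) * (2 * (25 : ℕ) + 3) : ℝ) := by
    push_cast
    nlinarith
  have htail := abs_sinIntegral_sub_taylor_le (4 * π) 25 hN
  rw [abs_of_pos hpos] at htail
  have htail' : (4 * π) ^ (2 * 25 + 1) / (Nat.factorial (2 * 25 + 1) : ℝ)
      ≤ (12.566370614359173 : ℝ) ^ (2 * 25 + 1) / (Nat.factorial (2 * 25 + 1) : ℝ) := by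
    gcongr
  -- split-sign enclosure of the polynomial
  have hpoly := sum_alternating_odd_pow_bounds 25
    (fun k => 1 / ((2 * k + 1 : ℝ) * (Nat.factorial (2 * k + 1) : ℝ))) (fun k => by positivity)
    (by norm_num : (0 : ℝ) ≤ 12.566370614359172) hlo.le hhi.le
  have hPeq : (∑ k ∈ Finset.range 25,
      (-1 : ℝ) ^ k * (1 / ((2 * k + 1 : ℝ) * (Nat.factorial (2 * k + 1) : ℝ))) * (4 * π) ^ (2 * k + 1))
      = ∑ k ∈ Finset.range 25, (-1 : ℝ) ^ k * (4 * π) ^ (2 * k + 1) /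
        ((2 * k + 1 : ℝ) * (Nat.factorial (2 * k + 1) : ℝ)) := by
    refine Finset.sum_congr rfl fun k _ => ?_
    ring
  rw [hPeq] at hpoly
  obtain ⟨hP1, hP2⟩ := hpoly
  obtain ⟨hc1, hc2⟩ := sinIntegral_taylor25_core
  rw [abs_le] at htail
  obtain ⟨ht1, ht2⟩ := htail
  constructor
  · linarith
  · linarith

/-- **`δ(1)` enclosed**: `2.23748483484 ≤ traceRemainder 1 ≤ 2.23748483504` (`δ(1) = 2(Si(4π)/(4π)+1)`,
`traceRemainder_one`). [cite: ConnesConsani2021, §2 eq. (26) p. 11; Remark 4.6 (i) §4 p. 18 (arXiv chunk p0018:L2–L5)] -/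
theorem traceRemainder_one_mem_Icc :
    (2.23748483484 : ℝ) ≤ traceRemainder 1 ∧ traceRemainder 1 ≤ (2.23748483504 : ℝ) := by
  rw [traceRemainder_one]
  obtain ⟨h1, h2⟩ := sinIntegral_four_pi_mem_Icc
  have hpi1 := Real.pi_gt_d20
  have hpi2 := Real.pi_lt_d20
  have hpos : (0 : ℝ) < 4 * π := by positivity
  have hq1 : (1.492161225 : ℝ) / (4 * 3.14159265358979323847) ≤ sinIntegral (4 * π) / (4 * π) := by
    rw [div_le_div_iff₀ (by norm_num) hpos]
    have : (0 : ℝ) ≤ sinIntegral (4 * π) := by linarith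
    nlinarith
  have hq2 : sinIntegral (4 * π) / (4 * π) ≤ (1.492161226 : ℝ) / (4 * 3.14159265358979323846) := by
    rw [div_le_div_iff₀ hpos (by norm_num)]
    nlinarith
  constructor
  · have : (0.11874241742 : ℝ) ≤ (1.492161225 : ℝ) / (4 * 3.14159265358979323847) := by norm_num
    linarith
  · have : (1.492161226 : ℝ) / (4 * 3.14159265358979323846) ≤ (0.11874241752 : ℝ) := by norm_num
    linarith

/-- **DISCHARGE of `CC2021_rem_4_6_i_numerics`**: the printed numerical check of Connes–Consani 2021,
Remark 4.6 (i) — `δ(1) = 2(Si(4π)/(4π) + 1) ∼ 2.237484835` — holds as typed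
(`|traceRemainder 1 − 2.237484835| ≤ 10⁻⁹`), certified in the kernel from the Taylor series of `Si` and
Mathlib's 20-digit enclosure of `π`.  RH-FREE. [cite: ConnesConsani2021, Remark 4.6 (i) §4 p. 18 (arXiv item Remark 26, chunk p0018:L2–L5); §2 eq. (26) p. 11] -/
theorem CC2021_rem_4_6_i_numerics_holds : CC2021_rem_4_6_i_numerics := by
  unfold CC2021_rem_4_6_i_numerics
  obtain ⟨h1, h2⟩ := traceRemainder_one_mem_Icc
  rw [abs_le]
  constructor
  · norm_num at h1 h2 ⊢
    linarith
  · norm_num at h1 h2 ⊢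
    linarith

end Literature.NumberTheory.ConnesConsani2021

end
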